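import Summits.QuantumFields.YangMills.Theorems.UnitScaleTiltProp7SpanProjectorGramForm
import Summits.QuantumFields.YangMills.Theorems.UnitScaleTiltProp7ProjectorPerturbation
import HarnessLib

/-!
# Route `UnitScaleTilt`, crux K1 «MinimiserStabilityRegPr» (stmt-QuantumFields-19200), EX row `hGF[Lift]` (curved member) — **LOD LINE, PEN (L5″) FILE 2y (ABSTRACT, GRAM LETTERS):
# THE PROJECTOR TELESCOPE IN THE COORDINATES OF ✓`Prop7SpanProjectorGramForm`** — for two finite families `v, v′` with invertible Gram matrices `M, M′` spanning `K, K′`: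
# `⟪g, P f − P′ f⟫ = Σ (ā−ā′)·M⁻¹b + Σ ā′·(M⁻¹−M′⁻¹)b + Σ ā′·M′⁻¹(b−b′)` (`a_y = ⟪v_y, g⟫`, `b_y = ⟪v_y, f⟫`, primes for `v′`), hence
# `‖⟪g,(P − P′)f⟫‖ ≤ (δ₁νβ + β′δ₂ + β′ν′δ₁)·‖g‖·‖f‖` from THREE LOCAL COORDINATE ROWS — the `hloc` of ✓`Prop7PTermLocalGaugeKnit` ∕ ✓`Prop7ProjectorPerturbationLocal` in the letters
# the member files speak (routeR-w2 ✓`Prop7ComplementaryProjectorColumns`: `v_i = G(T(b_i))`, `M = Gram`).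

Cell `ym3-torus` (HUMAN RULING D-0037, YM ladder rung R3 — NOT d = 4, NOT infinite volume, NOT a mass gap, NOT Clay).  Width seat `ym-routeR-w3` gen 12; ★p1 g24
LOCATE-L6-ASSEMBLY §1 Step I.2 (L5″), road (α); this seat's LOCATE-L5pp-FILE2 (bce81fab) §0–§1.  THEOREMS ONLY (0 `def`, 0 `sorry`), Mathlib + ✓`Prop7SpanProjectorGramForm`
(`inner_starProjection_eq_gramSum`) + ✓`Prop7ProjectorPerturbation` (`norm_sum_star_mul_mulVec_le`, `norm_sum_star_mul_le_sqrt_mul_sqrt`, `sqrt_normSq_mulVec_le`); `--supports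
stmt-QuantumFields-19200 --as helper`, count-neutral.  HONEST LABEL (★★OWNER RULING №33 (6)): curved γ-row supplier line (LOD localisation), pen (L5″); abstract algebra — nothing of
(3.49), Thm 3.1∕3.3, `h349`, `hGF`, EX ∕ 19200 is proved here.

THE THREE LOCAL ROWS (hypotheses ON THE VECTORS `f, g`; `√Σ` = the `ℓ²` norm over the coarse index; `‖·‖` on matrices = Mathlib's `L²`-operator norm):
(R-B) `√Σ_y‖⟪v_y,h⟫ − ⟪v′_y,h⟫‖² ≤ δ₁‖h‖` at `h = f, g` (columns of the two systems pair alike with vectors localised at the cube);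
(R-N) `√Σ_y‖((M⁻¹ − M′⁻¹)b)_y‖² ≤ δ₂‖f‖` for `b_y = ⟪v_y,f⟫` (the inverse Grams agree on the coarse vector in play);
global: `‖M⁻¹‖ ≤ ν`, `‖M′⁻¹‖ ≤ ν′` ((L4′) coercivity, ✓`l2_opNorm_gram_inv_le_of_coercive`-class), Bessel-type column bounds `√Σ‖⟪v_y,h⟫‖² ≤ β‖h‖`, `√Σ‖⟪v′_y,h⟫‖² ≤ β′‖h‖`.

WHAT IS PROVED (ns `Summit.QuantumFields.YangMills.Theorems.Prop7ProjectorPerturbationGram`).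
* §1 `sum_sum_eq_sum_star_mulVec` (`Σ_yΣ_{y′} conj(a_y)N_{yy′}b_{y′} = Σ_y conj(a_y)(Nb)_y`), `gramSum_telescope` (the three-term identity on the double sums).
* §2 ★★ `inner_starProjection_sub_eq_telescope` (the telescope for `⟪g, Pf⟫ − ⟪g, P′f⟫`), ★★★ `norm_inner_starProjection_sub_le` (the bound with the three local rows).

References: T. Bałaban, CMP **99** (1985) 389–434 [Balaban1985BackgroundPropagators] ((3.20)–(3.23) p.394, (3.49) p.399, (3.105) p.414).
-/

set_option autoImplicit false

noncomputable section

open scoped InnerProductSpace ComplexConjugate BigOperators Matrix Matrix.Norms.L2Operator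
open Finset

namespace Summit.QuantumFields.YangMills.Theorems.Prop7ProjectorPerturbationGram

open Summit.QuantumFields.YangMills.Theorems.Prop7SpanProjectorGramForm (inner_starProjection_eq_gramSum)
open Summit.QuantumFields.YangMills.Theorems.Prop7ProjectorPerturbation (norm_sum_star_mul_mulVec_le norm_sum_star_mul_le_sqrt_mul_sqrt sqrt_normSq_mulVec_le)

variable {E : Type*} [NormedAddCommGroup E] [InnerProductSpace ℂ E] {m : Type*} [Fintype m] [DecidableEq m]

/-! ## §1 Double sums as pairings with `N *ᵥ b`; the telescope -/

omit [DecidableEq m] in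
/-- `Σ_y Σ_{y′} conj(a_y)·N_{yy′}·b_{y′} = Σ_y conj(a_y)·(N b)_y`. [folklore] -/
theorem sum_sum_eq_sum_star_mulVec (a b : m → ℂ) (N : Matrix m m ℂ) :
    ∑ y, ∑ y', (starRingEnd ℂ) (a y) * N y y' * b y' = ∑ y, star (a y) * (N *ᵥ b) y := by
  refine Finset.sum_congr rfl fun y _ => ?_
  rw [Matrix.mulVec, dotProduct, Finset.mul_sum]
  refine Finset.sum_congr rfl fun y' _ => ?_
  rw [Complex.star_def]; ring

omit [DecidableEq m] in
/-- **THE TELESCOPE ON THE DOUBLE SUMS**: `⟨a,Nb⟩ − ⟨a′,N′b′⟩ = ⟨a − a′, Nb⟩ + ⟨a′,(N − N′)b⟩ + ⟨a′, N′(b − b′)⟩` (pairings `Σ_y conj(·)_y (·)_y`).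
[cite: Balaban1985BackgroundPropagators, (3.105) p.414] -/
theorem gramSum_telescope (a a' b b' : m → ℂ) (N N' : Matrix m m ℂ) :
    ∑ y, star (a y) * (N *ᵥ b) y - ∑ y, star (a' y) * (N' *ᵥ b') y
      = ∑ y, star ((a - a') y) * (N *ᵥ b) y + ∑ y, star (a' y) * ((N - N') *ᵥ b) y + ∑ y, star (a' y) * (N' *ᵥ (b - b')) y := by
  simp only [Pi.sub_apply, star_sub, Matrix.sub_mulVec, Matrix.mulVec_sub, sub_mul, mul_sub, Finset.sum_sub_distrib]
  ring

/-! ## §2 The telescope and the bound for `⟪g, Pf − P′f⟫` -/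

/-- ★★ **THE PROJECTOR TELESCOPE IN GRAM COORDINATES**: for families `v, v′` with Gram matrices `M, M′` (invertible) spanning `K, K′` (orthogonal projections `P, P′`):
`⟪g, Pf − P′f⟫ = ⟨a − a′, M⁻¹b⟩ + ⟨a′, (M⁻¹ − M′⁻¹)b⟩ + ⟨a′, M′⁻¹(b − b′)⟩` with `a_y = ⟪v_y,g⟫`, `a′_y = ⟪v′_y,g⟫`, `b_y = ⟪v_y,f⟫`, `b′_y = ⟪v′_y,f⟫`
(✓`inner_starProjection_eq_gramSum` twice). [cite: Balaban1985BackgroundPropagators, (3.20)–(3.23) p.394, (3.105) p.414] -/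
theorem inner_starProjection_sub_eq_telescope (v v' : m → E) {M M' : Matrix m m ℂ} (hM : ∀ y y', M y y' = ⟪v y, v y'⟫_ℂ) (hM' : ∀ y y', M' y y' = ⟪v' y, v' y'⟫_ℂ)
    (hunit : IsUnit M.det) (hunit' : IsUnit M'.det) (K K' : Submodule ℂ E) [K.HasOrthogonalProjection] [K'.HasOrthogonalProjection]
    (hvK : ∀ y, v y ∈ K) (hKv : K ≤ Submodule.span ℂ (Set.range v)) (hvK' : ∀ y, v' y ∈ K') (hKv' : K' ≤ Submodule.span ℂ (Set.range v')) (f g : E) :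
    ⟪g, K.starProjection f - K'.starProjection f⟫_ℂ
      = ∑ y, star ((fun y => ⟪v y, g⟫_ℂ) - (fun y => ⟪v' y, g⟫_ℂ)) y * (M⁻¹ *ᵥ fun y' => ⟪v y', f⟫_ℂ) y
        + ∑ y, star (⟪v' y, g⟫_ℂ) * ((M⁻¹ - M'⁻¹) *ᵥ fun y' => ⟪v y', f⟫_ℂ) y
        + ∑ y, star (⟪v' y, g⟫_ℂ) * (M'⁻¹ *ᵥ ((fun y' => ⟪v y', f⟫_ℂ) - fun y' => ⟪v' y', f⟫_ℂ)) y := by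
  rw [inner_sub_right, inner_starProjection_eq_gramSum v hM hunit K hvK hKv g f, inner_starProjection_eq_gramSum v' hM' hunit' K' hvK' hKv' g f,
    sum_sum_eq_sum_star_mulVec, sum_sum_eq_sum_star_mulVec]
  exact gramSum_telescope _ _ _ _ _ _

/-- ★★★ **THE BILINEAR BOUND FROM THREE LOCAL COORDINATE ROWS** — with `a, a′, b, b′` as above, global `‖M⁻¹‖ ≤ ν`, `‖M′⁻¹‖ ≤ ν′`, Bessel-type column bounds
`√Σ‖⟪v_y,f⟫‖² ≤ β‖f‖`, `√Σ‖⟪v′_y,g⟫‖² ≤ β′‖g‖`, and the LOCAL rows (R-B) `√Σ‖⟪v_y,h⟫ − ⟪v′_y,h⟫‖² ≤ δ₁‖h‖` at `h = f, g`, (R-N) `√Σ‖((M⁻¹ − M′⁻¹)b)_y‖² ≤ δ₂‖f‖`: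
**`‖⟪g, Pf − P′f⟫‖ ≤ (δ₁·ν·β + β′·δ₂ + β′·ν′·δ₁)·‖g‖·‖f‖`** — the coordinate edition of ✓`Prop7ProjectorPerturbationLocal.norm_inner_proj_sub_proj_le`; at `g := f` it is the `hloc` of
✓`Prop7PTermLocalGaugeKnit.abs_normSq_Pterm_sub_flat_le` (with `Pf − P′f = (f − R f) − (f − R′f)`, `R = projR …`). [cite: Balaban1985BackgroundPropagators, (3.49) p.399, (3.105) p.414] -/
theorem norm_inner_starProjection_sub_le (v v' : m → E) {M M' : Matrix m m ℂ} (hM : ∀ y y', M y y' = ⟪v y, v y'⟫_ℂ) (hM' : ∀ y y', M' y y' = ⟪v' y, v' y'⟫_ℂ)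
    (hunit : IsUnit M.det) (hunit' : IsUnit M'.det) (K K' : Submodule ℂ E) [K.HasOrthogonalProjection] [K'.HasOrthogonalProjection]
    (hvK : ∀ y, v y ∈ K) (hKv : K ≤ Submodule.span ℂ (Set.range v)) (hvK' : ∀ y, v' y ∈ K') (hKv' : K' ≤ Submodule.span ℂ (Set.range v')) (f g : E)
    {ν ν' β β' δ₁ δ₂ : ℝ} (hν : 0 ≤ ν) (hν' : 0 ≤ ν') (hβ' : 0 ≤ β') (hδ₁ : 0 ≤ δ₁)
    (hN : ‖M⁻¹‖ ≤ ν) (hN' : ‖M'⁻¹‖ ≤ ν')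
    (hb : Real.sqrt (∑ y, ‖⟪v y, f⟫_ℂ‖ ^ 2) ≤ β * ‖f‖) (ha' : Real.sqrt (∑ y, ‖⟪v' y, g⟫_ℂ‖ ^ 2) ≤ β' * ‖g‖)
    (h1f : Real.sqrt (∑ y, ‖⟪v y, f⟫_ℂ - ⟪v' y, f⟫_ℂ‖ ^ 2) ≤ δ₁ * ‖f‖) (h1g : Real.sqrt (∑ y, ‖⟪v y, g⟫_ℂ - ⟪v' y, g⟫_ℂ‖ ^ 2) ≤ δ₁ * ‖g‖)
    (h2 : Real.sqrt (∑ y, ‖((M⁻¹ - M'⁻¹) *ᵥ fun y' => ⟪v y', f⟫_ℂ) y‖ ^ 2) ≤ δ₂ * ‖f‖) :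
    ‖⟪g, K.starProjection f - K'.starProjection f⟫_ℂ‖ ≤ (δ₁ * ν * β + β' * δ₂ + β' * ν' * δ₁) * ‖g‖ * ‖f‖ := by
  rw [inner_starProjection_sub_eq_telescope v v' hM hM' hunit hunit' K K' hvK hKv hvK' hKv' f g]
  set a : m → ℂ := fun y => ⟪v y, g⟫_ℂ with ha_def
  set a' : m → ℂ := fun y => ⟪v' y, g⟫_ℂ with ha'_def
  set b : m → ℂ := fun y' => ⟪v y', f⟫_ℂ with hb_def
  set b' : m → ℂ := fun y' => ⟪v' y', f⟫_ℂ with hb'_def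
  have hg0 : 0 ≤ ‖g‖ := norm_nonneg _
  have hf0 : 0 ≤ ‖f‖ := norm_nonneg _
  -- the coordinate rows in `Real.sqrt` currency
  have hAg : Real.sqrt (∑ y, ‖(a - a') y‖ ^ 2) ≤ δ₁ * ‖g‖ := h1g
  have hBf : Real.sqrt (∑ y, ‖(b - b') y‖ ^ 2) ≤ δ₁ * ‖f‖ := h1f
  have hA' : Real.sqrt (∑ y, ‖a' y‖ ^ 2) ≤ β' * ‖g‖ := ha'
  have hB : Real.sqrt (∑ y, ‖b y‖ ^ 2) ≤ β * ‖f‖ := hb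
  -- term 1: `|⟨a − a′, M⁻¹ b⟩| ≤ ‖M⁻¹‖·‖a − a′‖·‖b‖ ≤ ν·δ₁‖g‖·β‖f‖`
  have t1 : ‖∑ y, star ((a - a') y) * (M⁻¹ *ᵥ b) y‖ ≤ (δ₁ * ‖g‖) * (ν * (β * ‖f‖)) := by
    calc ‖∑ y, star ((a - a') y) * (M⁻¹ *ᵥ b) y‖ ≤ ‖M⁻¹‖ * Real.sqrt (∑ y, ‖(a - a') y‖ ^ 2) * Real.sqrt (∑ y, ‖b y‖ ^ 2) :=
          norm_sum_star_mul_mulVec_le _ _ _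
      _ = Real.sqrt (∑ y, ‖(a - a') y‖ ^ 2) * (‖M⁻¹‖ * Real.sqrt (∑ y, ‖b y‖ ^ 2)) := by ring
      _ ≤ (δ₁ * ‖g‖) * (ν * (β * ‖f‖)) :=
          mul_le_mul hAg (mul_le_mul hN hB (Real.sqrt_nonneg _) hν) (by positivity) (by positivity)
  -- term 2: `|⟨a′, (M⁻¹ − M′⁻¹) b⟩| ≤ ‖a′‖·‖(M⁻¹ − M′⁻¹)b‖ ≤ β′‖g‖·δ₂‖f‖`
  have t2 : ‖∑ y, star (a' y) * ((M⁻¹ - M'⁻¹) *ᵥ b) y‖ ≤ (β' * ‖g‖) * (δ₂ * ‖f‖) :=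
    (norm_sum_star_mul_le_sqrt_mul_sqrt _ _).trans (mul_le_mul hA' h2 (Real.sqrt_nonneg _) (by positivity))
  -- term 3: `|⟨a′, M′⁻¹ (b − b′)⟩| ≤ ‖M′⁻¹‖·‖a′‖·‖b − b′‖ ≤ ν′·β′‖g‖·δ₁‖f‖`
  have t3 : ‖∑ y, star (a' y) * (M'⁻¹ *ᵥ (b - b')) y‖ ≤ (β' * ‖g‖) * (ν' * (δ₁ * ‖f‖)) := by
    calc ‖∑ y, star (a' y) * (M'⁻¹ *ᵥ (b - b')) y‖ ≤ ‖M'⁻¹‖ * Real.sqrt (∑ y, ‖a' y‖ ^ 2) * Real.sqrt (∑ y, ‖(b - b') y‖ ^ 2) :=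
          norm_sum_star_mul_mulVec_le _ _ _
      _ = Real.sqrt (∑ y, ‖a' y‖ ^ 2) * (‖M'⁻¹‖ * Real.sqrt (∑ y, ‖(b - b') y‖ ^ 2)) := by ring
      _ ≤ (β' * ‖g‖) * (ν' * (δ₁ * ‖f‖)) :=
          mul_le_mul hA' (mul_le_mul hN' hBf (Real.sqrt_nonneg _) hν') (by positivity) (by positivity)
  calc ‖∑ y, star ((a - a') y) * (M⁻¹ *ᵥ b) y + ∑ y, star (a' y) * ((M⁻¹ - M'⁻¹) *ᵥ b) y + ∑ y, star (a' y) * (M'⁻¹ *ᵥ (b - b')) y‖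
      ≤ ‖∑ y, star ((a - a') y) * (M⁻¹ *ᵥ b) y‖ + ‖∑ y, star (a' y) * ((M⁻¹ - M'⁻¹) *ᵥ b) y‖ + ‖∑ y, star (a' y) * (M'⁻¹ *ᵥ (b - b')) y‖ := norm_add₃_le
    _ ≤ (δ₁ * ‖g‖) * (ν * (β * ‖f‖)) + (β' * ‖g‖) * (δ₂ * ‖f‖) + (β' * ‖g‖) * (ν' * (δ₁ * ‖f‖)) := add_le_add (add_le_add t1 t2) t3
    _ = (δ₁ * ν * β + β' * δ₂ + β' * ν' * δ₁) * ‖g‖ * ‖f‖ := by ring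

end Summit.QuantumFields.YangMills.Theorems.Prop7ProjectorPerturbationGram

end
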